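import Literature.Probability.LatticeModels.CurrentsTraceLaw
import Literature.Probability.LatticeModels.CurrentsAvoidMixing
import HarnessLib

/-!
# Mixing of the trace limits of the random currents

Trunk G02 (T-STATMECH), topic `Probability/LatticeModels`, namespace `Literature.StatMech`. The limits
`lim_L P̂^#_{Λ_L,β}[n̂ ∩ F = U]` (`plusCurrentTraceLimit`, `freeCurrentTraceLimit`) and
`lim_L ℙ_{Λ_L,β}[ω ∩ F = U]` (`adsTraceLimit`) of `CurrentsTraceLaw.lean` are finite signed
combinations (inclusion–exclusion, product of the two currents) of the edge-avoidance limits of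
`CurrentsEdgeAvoidance.lean`. Their asymptotic factorisation under translation of one of the
events,

`lim_{‖x‖→∞} q(F ∪ (F'+x), U ∪ (U'+x)) = q(F,U) q(F',U')`

(`tendsto_plusCurrentTraceLimit_union_shift`, `tendsto_freeCurrentTraceLimit_union_shift`,
`tendsto_adsTraceLimit_union_shift`), therefore follows from that of the avoidance limits
(`CurrentsAvoidMixing.lean`) by finite sums. This is the step "In view of the conditional
independence of `n` given the parity variables `r`, the requirement can be further simplified to
the proof that for any two finite sets `E` and `F` of edges,
`lim P̂^#_β[𝒞_{E ∪ (x+F)}] = P̂^#_β[𝒞_E] P̂^#_β[𝒞_F]`" of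

* M. Aizenman, H. Duminil-Copin, V. Sidoravicius, *Random currents and continuity of Ising
  model's spontaneous magnetization*, Comm. Math. Phys. **334** (2015), proof of Thm. 2.3, R3
  (arXiv:1311.1937v3, p. 9),

in the ghost-free trace formulation of the tree (where the reduction is plain inclusion–exclusion).

## Mathlib status

Anchors: `Filter.cofinite`, `Filter.Tendsto.congr'`, `tendsto_finsetSum`, `Finset.sum_comm`,
`Finset.sum_mul_sum`; tree: `sum_powerset_union_of_disjoint`, `eventually_disjoint_image_pairShift`,
`tendsto_plusCurrentAvoidLimit_union_shift`, `tendsto_freeCurrentAvoidLimit_union_shift`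
(`CurrentsAvoidMixing.lean`), `sum_powerset_image_pairShift` (`CurrentsAvoidShift.lean`).
-/

noncomputable section

open MeasureTheory Filter Topology Finset Literature.Probability.LatticeModels Literature.Probability.Percolation
open scoped symmDiff

namespace Literature.Probability.LatticeModels

variable (d : ℕ)

/-! ### Set algebra of a set and a far translate -/

/-- Sums over the subsets of `U ∪ (U'+x)` for disjoint `U`, `U'+x`. [folklore] -/
theorem sum_powerset_union_image_pairShift {U U' : Finset (Sym2 (Site d))} {x : Site d}
    (h : Disjoint U (U'.image (pairShift d x))) (f : Finset (Sym2 (Site d)) → ℝ) :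
    ∑ W ∈ (U ∪ U'.image (pairShift d x)).powerset, f W =
      ∑ W₀ ∈ U.powerset, ∑ W₁ ∈ U'.powerset, f (W₀ ∪ W₁.image (pairShift d x)) := by
  rw [sum_powerset_union_of_disjoint h]
  exact Finset.sum_congr rfl fun W₀ _ => sum_powerset_image_pairShift d x U' _

/-- `(F ∪ F') ∖ (U ∪ U') = (F ∖ U) ∪ (F' ∖ U')` for `U ⊆ F`, `U' ⊆ F'`, `F ∩ F' = ∅`. [folklore] -/
theorem union_sdiff_union_of_disjoint {α : Type*} [DecidableEq α] {F F' U U' : Finset α}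
    (h : Disjoint F F') (hU : U ⊆ F) (hU' : U' ⊆ F') :
    (F ∪ F') \ (U ∪ U') = (F \ U) ∪ (F' \ U') := by
  ext e
  have h1 := fun (he : e ∈ F) (he' : e ∈ F') => Finset.disjoint_left.1 h he he'
  have h2 := fun (he : e ∈ U) => hU he
  have h3 := fun (he : e ∈ U') => hU' he
  simp only [Finset.mem_sdiff, Finset.mem_union]
  tauto

/-- `A ∪ B = U ∪ U'` with `A, U ⊆ F`, `B, U' ⊆ F'`, `F ∩ F' = ∅` iff `A = U` and `B = U'`. [folklore] -/
theorem union_eq_union_iff_of_disjoint {α : Type*} [DecidableEq α] {F F' A B U U' : Finset α}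
    (h : Disjoint F F') (hA : A ⊆ F) (hB : B ⊆ F') (hU : U ⊆ F) (hU' : U' ⊆ F') :
    A ∪ B = U ∪ U' ↔ A = U ∧ B = U' := by
  constructor
  · intro heq
    have hAF' : Disjoint A F' := h.mono_left hA
    have hUF' : Disjoint U F' := h.mono_left hU
    constructor
    · have h1 : (A ∪ B) ∩ F = A := by
        rw [Finset.union_inter_distrib_right, Finset.inter_eq_left.2 hA,
          Finset.disjoint_iff_inter_eq_empty.1 (h.symm.mono_left hB), Finset.union_empty]
      have h2 : (U ∪ U') ∩ F = U := by
        rw [Finset.union_inter_distrib_right, Finset.inter_eq_left.2 hU,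
          Finset.disjoint_iff_inter_eq_empty.1 (h.symm.mono_left hU'), Finset.union_empty]
      rw [← h1, heq, h2]
    · have h1 : (A ∪ B) ∩ F' = B := by
        rw [Finset.union_inter_distrib_right, Finset.inter_eq_left.2 hB,
          Finset.disjoint_iff_inter_eq_empty.1 hAF', Finset.empty_union]
      have h2 : (U ∪ U') ∩ F' = U' := by
        rw [Finset.union_inter_distrib_right, Finset.inter_eq_left.2 hU',
          Finset.disjoint_iff_inter_eq_empty.1 hUF', Finset.empty_union]
      rw [← h1, heq, h2]
  · rintro ⟨rfl, rfl⟩; rfl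

/-- The argument of the avoidance limit in the inclusion–exclusion for `F ∪ (F'+x)`:
`((F ∪ F'_x) ∖ (U ∪ U'_x)) ∪ (W₀ ∪ W₁_x) = ((F ∖ U) ∪ W₀) ∪ ((F' ∖ U') ∪ W₁)_x`. [folklore] -/
theorem traceArg_union_shift {F F' U U' W₀ W₁ : Finset (Sym2 (Site d))} {x : Site d}
    (h : Disjoint F (F'.image (pairShift d x))) (hU : U ⊆ F) (hU' : U' ⊆ F') :
    (F ∪ F'.image (pairShift d x)) \ (U ∪ U'.image (pairShift d x)) ∪ (W₀ ∪ W₁.image (pairShift d x)) =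
      (F \ U ∪ W₀) ∪ ((F' \ U') ∪ W₁).image (pairShift d x) := by
  rw [union_sdiff_union_of_disjoint h hU (Finset.image_subset_image hU'),
    ← Finset.image_sdiff _ _ (pairShift_injective d x), Finset.image_union]
  ext e
  simp only [Finset.mem_union]
  tauto

/-! ### Single currents -/

/-- **Mixing of the plus trace limits**: for `β ≥ 0`, `U ⊆ F`, `U' ⊆ F'`,
`lim_L P̂⁺[n̂ ∩ (F ∪ F'_x) = U ∪ U'_x] → (lim_L P̂⁺[n̂ ∩ F = U])(lim_L P̂⁺[n̂ ∩ F' = U'])` as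
`x → ∞`. [cite: AizenmanDuminilCopinSidoraviciusCMP2015, Thm. 2.3 (proof of R3)] -/
theorem tendsto_plusCurrentTraceLimit_union_shift {β : ℝ} (hβ : 0 ≤ β)
    {F U F' U' : Finset (Sym2 (Site d))} (hU : U ⊆ F) (hU' : U' ⊆ F') :
    Tendsto (fun x : Site d => plusCurrentTraceLimit d β (F ∪ F'.image (pairShift d x))
      (U ∪ U'.image (pairShift d x))) cofinite
      (𝓝 (plusCurrentTraceLimit d β F U * plusCurrentTraceLimit d β F' U')) := by
  set g : Site d → ℝ := fun x => ∑ W₀ ∈ U.powerset, ∑ W₁ ∈ U'.powerset,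
    (-1 : ℝ) ^ #W₀ * (-1 : ℝ) ^ #W₁ *
      plusCurrentAvoidLimit d β ((F \ U ∪ W₀) ∪ ((F' \ U') ∪ W₁).image (pairShift d x)) with hg
  have heq : (fun x : Site d => plusCurrentTraceLimit d β (F ∪ F'.image (pairShift d x))
      (U ∪ U'.image (pairShift d x))) =ᶠ[cofinite] g := by
    filter_upwards [eventually_disjoint_image_pairShift d F F'] with x hx
    have hUx : Disjoint U (U'.image (pairShift d x)) := hx.mono hU (Finset.image_subset_image hU')
    rw [plusCurrentTraceLimit, sum_powerset_union_image_pairShift d hUx, hg]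
    refine Finset.sum_congr rfl fun W₀ hW₀ => Finset.sum_congr rfl fun W₁ hW₁ => ?_
    have hW : Disjoint W₀ (W₁.image (pairShift d x)) :=
      hUx.mono (Finset.mem_powerset.1 hW₀) (Finset.image_subset_image (Finset.mem_powerset.1 hW₁))
    rw [Finset.card_union_of_disjoint hW, Finset.card_image_of_injective _ (pairShift_injective d x),
      pow_add, traceArg_union_shift d hx hU hU']
  refine (tendsto_congr' heq).2 ?_
  have hlim : Tendsto g cofinite (𝓝 (∑ W₀ ∈ U.powerset, ∑ W₁ ∈ U'.powerset,
      (-1 : ℝ) ^ #W₀ * (-1 : ℝ) ^ #W₁ *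
        (plusCurrentAvoidLimit d β (F \ U ∪ W₀) * plusCurrentAvoidLimit d β ((F' \ U') ∪ W₁)))) :=
    tendsto_finsetSum _ fun W₀ _ => tendsto_finsetSum _ fun W₁ _ =>
      (tendsto_plusCurrentAvoidLimit_union_shift d hβ _ _).const_mul _
  convert hlim using 2
  rw [plusCurrentTraceLimit, plusCurrentTraceLimit, Finset.sum_mul_sum]
  refine Finset.sum_congr rfl fun W₀ _ => Finset.sum_congr rfl fun W₁ _ => ?_
  ring

/-- **Mixing of the free trace limits** (lattice `F, F'`): for `β ≥ 0`, `U ⊆ F`, `U' ⊆ F'`,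
`lim_L P̂⁰[n̂ ∩ (F ∪ F'_x) = U ∪ U'_x] → (lim_L P̂⁰[n̂ ∩ F = U])(lim_L P̂⁰[n̂ ∩ F' = U'])` as
`x → ∞`. [cite: AizenmanDuminilCopinSidoraviciusCMP2015, Thm. 2.3 (proof of R3)] -/
theorem tendsto_freeCurrentTraceLimit_union_shift {β : ℝ} (hβ : 0 ≤ β)
    {F U F' U' : Finset (Sym2 (Site d))} (hF : ↑F ⊆ (zdGraph d).edgeSet)
    (hF' : ↑F' ⊆ (zdGraph d).edgeSet) (hU : U ⊆ F) (hU' : U' ⊆ F') :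
    Tendsto (fun x : Site d => freeCurrentTraceLimit d β (F ∪ F'.image (pairShift d x))
      (U ∪ U'.image (pairShift d x))) cofinite
      (𝓝 (freeCurrentTraceLimit d β F U * freeCurrentTraceLimit d β F' U')) := by
  set g : Site d → ℝ := fun x => ∑ W₀ ∈ U.powerset, ∑ W₁ ∈ U'.powerset,
    (-1 : ℝ) ^ #W₀ * (-1 : ℝ) ^ #W₁ *
      freeCurrentAvoidLimit d β ((F \ U ∪ W₀) ∪ ((F' \ U') ∪ W₁).image (pairShift d x)) with hg
  have heq : (fun x : Site d => freeCurrentTraceLimit d β (F ∪ F'.image (pairShift d x))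
      (U ∪ U'.image (pairShift d x))) =ᶠ[cofinite] g := by
    filter_upwards [eventually_disjoint_image_pairShift d F F'] with x hx
    have hUx : Disjoint U (U'.image (pairShift d x)) := hx.mono hU (Finset.image_subset_image hU')
    rw [freeCurrentTraceLimit, sum_powerset_union_image_pairShift d hUx, hg]
    refine Finset.sum_congr rfl fun W₀ hW₀ => Finset.sum_congr rfl fun W₁ hW₁ => ?_
    have hW : Disjoint W₀ (W₁.image (pairShift d x)) :=
      hUx.mono (Finset.mem_powerset.1 hW₀) (Finset.image_subset_image (Finset.mem_powerset.1 hW₁))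
    rw [Finset.card_union_of_disjoint hW, Finset.card_image_of_injective _ (pairShift_injective d x),
      pow_add, traceArg_union_shift d hx hU hU']
  refine (tendsto_congr' heq).2 ?_
  have hsub : ∀ {G V W : Finset (Sym2 (Site d))}, (↑G : Set (Sym2 (Site d))) ⊆ (zdGraph d).edgeSet →
      W ∈ V.powerset → V ⊆ G → (↑(G \ V ∪ W) : Set (Sym2 (Site d))) ⊆ (zdGraph d).edgeSet := by
    intro G V W hG hW hV e he
    rw [Finset.coe_union, Set.mem_union, Finset.mem_coe, Finset.mem_coe, Finset.mem_sdiff] at he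
    rcases he with ⟨he, -⟩ | he
    · exact hG he
    · exact hG (hV (Finset.mem_powerset.1 hW he))
  have hlim : Tendsto g cofinite (𝓝 (∑ W₀ ∈ U.powerset, ∑ W₁ ∈ U'.powerset,
      (-1 : ℝ) ^ #W₀ * (-1 : ℝ) ^ #W₁ *
        (freeCurrentAvoidLimit d β (F \ U ∪ W₀) * freeCurrentAvoidLimit d β ((F' \ U') ∪ W₁)))) :=
    tendsto_finsetSum _ fun W₀ hW₀ => tendsto_finsetSum _ fun W₁ hW₁ =>
      (tendsto_freeCurrentAvoidLimit_union_shift d hβ (hsub hF hW₀ hU) (hsub hF' hW₁ hU')).const_mul _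
  convert hlim using 2
  rw [freeCurrentTraceLimit, freeCurrentTraceLimit, Finset.sum_mul_sum]
  refine Finset.sum_congr rfl fun W₀ _ => Finset.sum_congr rfl fun W₁ _ => ?_
  ring

/-! ### The double current -/

/-- **Mixing of the double-current trace limits** (lattice `F, F'`): for `β ≥ 0`, `U ⊆ F`,
`U' ⊆ F'`, `lim_L ℙ_{Λ_L,β}[ω ∩ (F ∪ F'_x) = U ∪ U'_x] → q(F,U) q(F',U')` as `x → ∞`, where
`q(F,U) = lim_L ℙ_{Λ_L,β}[ω ∩ F = U]` (`adsTraceLimit`). [cite: AizenmanDuminilCopinSidoraviciusCMP2015, Thm. 2.3 (proof of R3)] -/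
theorem tendsto_adsTraceLimit_union_shift {β : ℝ} (hβ : 0 ≤ β)
    {F U F' U' : Finset (Sym2 (Site d))} (hF : ↑F ⊆ (zdGraph d).edgeSet)
    (hF' : ↑F' ⊆ (zdGraph d).edgeSet) (hU : U ⊆ F) (hU' : U' ⊆ F') :
    Tendsto (fun x : Site d => adsTraceLimit d β (F ∪ F'.image (pairShift d x))
      (U ∪ U'.image (pairShift d x))) cofinite
      (𝓝 (adsTraceLimit d β F U * adsTraceLimit d β F' U')) := by
  classical
  -- the quadruple-sum expression, valid for `x` with `F ∩ F'_x = ∅`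
  set g : Site d → ℝ := fun x => ∑ V₁ ∈ U.powerset, ∑ V₁' ∈ U'.powerset,
    ∑ V₂ ∈ U.powerset, ∑ V₂' ∈ U'.powerset,
      if V₁ ∪ V₂ = U ∧ V₁' ∪ V₂' = U' then
        freeCurrentTraceLimit d β (F ∪ F'.image (pairShift d x)) (V₁ ∪ V₁'.image (pairShift d x)) *
          plusCurrentTraceLimit d β (F ∪ F'.image (pairShift d x)) (V₂ ∪ V₂'.image (pairShift d x))
      else 0 with hg
  have heq : (fun x : Site d => adsTraceLimit d β (F ∪ F'.image (pairShift d x))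
      (U ∪ U'.image (pairShift d x))) =ᶠ[cofinite] g := by
    filter_upwards [eventually_disjoint_image_pairShift d F F'] with x hx
    have hUx : Disjoint U (U'.image (pairShift d x)) := hx.mono hU (Finset.image_subset_image hU')
    rw [adsTraceLimit, sum_powerset_union_image_pairShift d hUx, hg]
    refine Finset.sum_congr rfl fun V₁ hV₁ => Finset.sum_congr rfl fun V₁' hV₁' => ?_
    rw [sum_powerset_union_image_pairShift d hUx]
    refine Finset.sum_congr rfl fun V₂ hV₂ => Finset.sum_congr rfl fun V₂' hV₂' => ?_
    have hV₁ := Finset.mem_powerset.1 hV₁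
    have hV₂ := Finset.mem_powerset.1 hV₂
    have hV₁' := Finset.mem_powerset.1 hV₁'
    have hV₂' := Finset.mem_powerset.1 hV₂'
    -- the condition splits
    have hcond : V₁ ∪ V₁'.image (pairShift d x) ∪ (V₂ ∪ V₂'.image (pairShift d x)) =
        U ∪ U'.image (pairShift d x) ↔ V₁ ∪ V₂ = U ∧ V₁' ∪ V₂' = U' := by
      have hre : V₁ ∪ V₁'.image (pairShift d x) ∪ (V₂ ∪ V₂'.image (pairShift d x)) =
          (V₁ ∪ V₂) ∪ (V₁' ∪ V₂').image (pairShift d x) := by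
        rw [Finset.image_union]
        ext e; simp only [Finset.mem_union]; tauto
      rw [hre, union_eq_union_iff_of_disjoint hx ((Finset.union_subset hV₁ hV₂).trans hU)
        (Finset.image_subset_image ((Finset.union_subset hV₁' hV₂').trans hU')) hU
        (Finset.image_subset_image hU'), Finset.image_inj (pairShift_injective d x)]
    by_cases hc : V₁ ∪ V₂ = U ∧ V₁' ∪ V₂' = U'
    · rw [if_pos (hcond.2 hc), if_pos hc]
    · rw [if_neg (fun h' => hc (hcond.1 h')), if_neg hc]
  refine (tendsto_congr' heq).2 ?_
  -- termwise limits
  have hlim : Tendsto g cofinite (𝓝 (∑ V₁ ∈ U.powerset, ∑ V₁' ∈ U'.powerset,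
      ∑ V₂ ∈ U.powerset, ∑ V₂' ∈ U'.powerset,
        if V₁ ∪ V₂ = U ∧ V₁' ∪ V₂' = U' then
          (freeCurrentTraceLimit d β F V₁ * freeCurrentTraceLimit d β F' V₁') *
            (plusCurrentTraceLimit d β F V₂ * plusCurrentTraceLimit d β F' V₂')
        else 0)) := by
    refine tendsto_finsetSum _ fun V₁ hV₁ => tendsto_finsetSum _ fun V₁' hV₁' =>
      tendsto_finsetSum _ fun V₂ hV₂ => tendsto_finsetSum _ fun V₂' hV₂' => ?_
    by_cases hc : V₁ ∪ V₂ = U ∧ V₁' ∪ V₂' = U'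
    · simp only [if_pos hc]
      exact (tendsto_freeCurrentTraceLimit_union_shift d hβ hF hF'
        ((Finset.mem_powerset.1 hV₁).trans hU) ((Finset.mem_powerset.1 hV₁').trans hU')).mul
        (tendsto_plusCurrentTraceLimit_union_shift d hβ
          ((Finset.mem_powerset.1 hV₂).trans hU) ((Finset.mem_powerset.1 hV₂').trans hU'))
    · simp only [if_neg hc]
      exact tendsto_const_nhds
  convert hlim using 2
  -- the product of the two double sums is the quadruple sum
  rw [adsTraceLimit, adsTraceLimit, Finset.sum_mul_sum]
  refine Finset.sum_congr rfl fun V₁ _ => Finset.sum_congr rfl fun V₁' _ => ?_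
  rw [Finset.sum_mul_sum]
  refine Finset.sum_congr rfl fun V₂ _ => Finset.sum_congr rfl fun V₂' _ => ?_
  by_cases h1 : V₁ ∪ V₂ = U <;> by_cases h2 : V₁' ∪ V₂' = U' <;> simp [h1, h2]
  ring

end Literature.Probability.LatticeModels
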